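import Literature.Geometry.Lorentzian.CompleteDevelopmentMaximal
import Literature.Geometry.Lorentzian.FlatDevelopment
import Summits.FinalStateConjecture.FinalStateConjecture.Theorems.UniversalWitnessFamily.Negative.MinkowskiSettled
import Summits.FinalStateConjecture.FinalStateConjecture.Theorems.WeakCosmicCensorshipMGHD.Negative.LoadBearing
import Summits.FinalStateConjecture.FinalStateConjecture.Theorems.ClusterCompletenessOmegaLimitMultiKerrT2Defs
import Summits.FinalStateConjecture.FinalStateConjecture.Theorems.PhotonSphereChannelsChannelsResolveTameDevelopmentsRMinkowskiNoExtremalRemnant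
import HarnessLib

/-!
# Minkowski space is a CERTIFIED maximal development at which every hypothesis of the crux
# `ChannelsResolveTameDevelopmentsR` (K2R-T2, item `stmt-FinalStateConjecture-17430`) and its T2 conclusion hold
# (route PhotonSphereChannels; anti-vacuity at a certified MGHD, part 1)

Every audit of this crux (refuter `CruxAttack17430.md` §2, the lead's `PICKED.md`, the flat-class census
`Negative/SubMinkowski*`, `UniversalWitnessFamily.Negative.settles_trivialData_of`) names the same obstruction to
ANY kernel-checked instance of the route's statements: *"`IsMaximal` is uncertifiable for every model ⇒ neither a
model-proof nor a model-refutation is typable"*. That obstruction is now gone for geodesically complete developments: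
`Literature.Geometry.Lorentzian.Minkowski.isMaximal_vacuumCauchyDevelopment` (`CompleteDevelopmentMaximal.lean`, from
O'Neill 1983, Ch. 7, Cor. 7.29 and Choquet-Bruhat–Geroch 1969, Thm. 3): **Minkowski space IS the MGHD of the trivial
datum**, given the Choquet-Bruhat–Geroch existence theorem (`choquetBruhat_geroch_exists_mghd_cauchy`, a named fact of
the tree), and UNCONDITIONALLY every MGHD of the trivial datum is isometric to it.

This file (part 1; part 2 `…RTrivialDatum` draws the consequences for every MGHD of the trivial datum):

* `ray_eq_line`, `raysStayInClosure_minkowski` — the T2 ray clause at the Minkowski development (normalised rays are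
  the straight lines `ι p + t v`, `v⁰ = 1`, so `(γ t)⁰ = t ≥ 0`);
* `isFutureOriented_minkowskiDecomp` — the T2 orientation clause for the honest `N = 0` decomposition
  `UniversalWitnessFamily.Negative.minkowskiDecomp` (the identity flat chart pushes `∂₀` to `∂ₜ`);
* `settlesT2_minkowski : SettlesT2 Minkowski.vacuumCauchyDevelopment` — complete `𝓘⁺` and the full re-typed
  post-maximality conclusion at the Minkowski development;
* `minkowski_devHyp` — the standing hypotheses `TameHull.DevHyp` (MGHD, complete `𝓘⁺`, (i) no extremal remnant,
  (ii) tame outer region) at the Minkowski development, the maximality hypothesis of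
  `MinkowskiModel.minkowski_devHyp_of_isMaximal` now DISCHARGED (given CBG);
* `cruxHypotheses_minkowski` (registered stub) — **admissible datum ∧ `IsMaximal` ∧ complete `𝓘⁺` ∧ (i) ∧ (ii) ∧
  `SettlesT2`, all at ONE certified development**: the crux's hypothesis block is kernel-checked consistent and
  consistent with its conclusion; the refuter's "hyps satisfiable on paper" is now a theorem (given CBG).

No `sorry`; Mathlib + landed tree modules. References: Choquet-Bruhat–Geroch, CMP 14 (1969), Thm. 3; O'Neill,
*Semi-Riemannian Geometry* (1983), Ch. 3, Ex. 3.25, Ch. 7, Cor. 7.29; Christodoulou–Klainerman (1993), Thm. 1.0.2;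
Dafermos–Luk, arXiv:1710.01722, Conjecture 1; Dafermos–Rodnianski, arXiv:0811.0354, §5.1.
-/

noncomputable section

set_option linter.dupNamespace false

open Set Filter Function TopologicalSpace Metric
open scoped Manifold ContDiff Topology ENNReal NNReal

namespace Summit.FinalStateConjecture.FinalStateConjecture.Theorems.ChannelsResolveTameDevelopmentsR.TrivialDatum

open Literature.Geometry.Lorentzian Literature.Geometry.Lorentzian.Minkowski
open Summit.FinalStateConjecture.FinalStateConjecture.Theorems.UniversalWitnessFamily.Negative
  (minkowskiExterior minkowskiDecomp idFlatChart minkowskiExterior_eq_exteriorOf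
    hasExhaustiveCharts_minkowskiDecomp)
open Summit.FinalStateConjecture.FinalStateConjecture.Theorems.ClusterCompleteness (SettlesT2)
open Summit.FinalStateConjecture.FinalStateConjecture.Theorems.TameHull (NoExtremalRemnant TameOuter DevHyp)

/-! ### The two T2 clauses at the Minkowski development -/

/-- **A normalised future null ray of Minkowski space from the slice is the straight line
`γ t = ι p + t v` on its whole (interval) domain**, `v = γ'(0)` (geodesics of `η` are affinely
parametrised straight lines, O'Neill 1983, Ch. 3, Ex. 3.25: the line is a geodesic,
`ModelSpace.isGeodesic_line`, and geodesics with the same data agree, `PseudoRiemannianMetric.eqOn_of_isGeodesicOn`). -/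
theorem ray_eq_line [Minkowski.smoothMetric.toPseudoRiemannianMetric.HasLeviCivita] {p : slice}
    {γ : ℝ → E4} {dom : Set ℝ}
    (h : Minkowski.smoothMetric.IsNormalisedNullRayFrom (timeOrientation.ofLE le_top) sliceEmbed
      sliceNormal p γ dom) :
    ∃ v : E4, velocity 𝓘(ℝ, E4) γ 0 = v ∧ ∀ t ∈ dom, γ t = sliceEmbed p + t • v := by
  obtain ⟨hmax, h0, hγ0, -, -, -⟩ := h
  refine ⟨velocity 𝓘(ℝ, E4) γ 0, rfl, fun t ht ↦ ?_⟩
  set v : E4 := velocity 𝓘(ℝ, E4) γ 0 with hv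
  have hline : IsGeodesic Minkowski.smoothMetric.toPseudoRiemannianMetric.leviCivita
      (fun s : ℝ ↦ sliceEmbed p + s • v) :=
    ModelSpace.isGeodesic_line smoothMetric_val (sliceEmbed p) v
  have heq := PseudoRiemannianMetric.eqOn_of_isGeodesicOn
    (g := Minkowski.smoothMetric.toPseudoRiemannianMetric)
    hmax.isOpen hmax.2.1 hmax.isGeodesicOn (hline.mono (subset_univ _)) (t₀ := 0) h0
    (by simp [hγ0]) ((ModelSpace.velocity_line (sliceEmbed p) v 0).symm)
  exact heq ht

/-- **Every future-complete normalised null ray of Minkowski space from the slice stays in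
`O = {x⁰ ≥ 0}`** (the intrinsic lower bound `RaysStayInClosure` of the re-typed summit statement, at the
Minkowski development): the ray is the line `ι p + t v` with `(ι p)⁰ = 0` and `v⁰ = −η(v, ∂ₜ) = 1`
(normalisation), so `(γ t)⁰ = t ≥ 0`. [cite: DafermosLuk2017, Conjecture 1] -/
theorem raysStayInClosure_minkowski :
    _root_.Summit.FinalStateConjecture.RaysStayInClosure
      Minkowski.vacuumCauchyDevelopment.toCauchyDevelopment minkowskiExterior := by
  intro hLC p γ dom hray _hunb t ht ht0
  haveI : Minkowski.smoothMetric.toPseudoRiemannianMetric.HasLeviCivita := hLC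
  change ℝ → E4 at γ
  obtain ⟨v, hv, hline⟩ := ray_eq_line (p := p) hray
  obtain ⟨-, -, -, -, -, hnorm⟩ := hray
  -- normalisation: `v⁰ = 1`
  have hv0 : v 0 = 1 := by
    have h' : bilin (velocity 𝓘(ℝ, E4) γ 0) (E4.basisVector 0) = -1 := hnorm
    rw [hv, bilin_symm, bilin_basisVector_zero_left] at h'
    linarith
  refine subset_closure ?_
  show (0 : ℝ) ≤ (γ t) 0
  rw [hline t ht]
  have h00 : (sliceEmbed p) 0 = 0 := by rw [sliceEmbed_apply]; exact E4.ofTimeSpace_apply_zero 0 _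
  have : (sliceEmbed p + t • v) 0 = (sliceEmbed p) 0 + t * v 0 := by simp
  rw [this, h00, hv0]
  linarith

/-- **The identity flat chart of `minkowskiDecomp` is future-oriented**: no hole (orthochronous-motion
and near-zone clauses vacuous), and the push-forward of `∂₀` under the identity chart `E4 ↪ E4` is
`∂ₜ`, the orienting field of Minkowski space itself. [cite: arXiv08110354, §5.1] -/
theorem isFutureOriented_minkowskiDecomp :
    _root_.Summit.FinalStateConjecture.IsFutureOriented minkowskiDecomp := by
  refine ⟨fun i ↦ i.elim0, fun i ↦ i.elim0, ?_⟩
  change ∀ᶠ τ in atTop, ∀ x ∈ (Minkowski.backgroundOn ⊤).timeSlab τ,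
    Minkowski.spacetime.timeOrientation.IsFutureDirected
      (mfderiv 𝓘(ℝ, E4) (𝓡 4) idFlatChart x (E4.basisVector 0))
  refine Filter.Eventually.of_forall fun τ x _ ↦ ?_
  have hd : mfderiv 𝓘(ℝ, E4) (𝓡 4) idFlatChart x (E4.basisVector 0) = E4.basisVector 0 := by
    change mfderiv 𝓘(ℝ, E4) 𝓘(ℝ, E4) (Subtype.val : (⊤ : Opens E4) → E4) x (E4.basisVector 0) = _
    rw [mfderiv_subtypeVal]
    rfl
  rw [hd]
  exact Minkowski.spacetime.timeOrientation.isFutureDirected_vectorField (x : E4)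

/-- **Minkowski space settles in the full T2 sense** (`SettlesT2`): complete `𝓘⁺`
(`WeakCosmicCensorshipMGHD.Negative.minkowski_hasCompleteNullInfinity`) and the honest exhaustive
future-oriented ray-containing `N = 0` decomposition `minkowskiDecomp` of `O = {x⁰ ≥ 0} = exteriorOf`.
Christodoulou–Klainerman 1993, Thm. 1.0.2. [cite: ChristodoulouKlainerman1993, Thm. 1.0.2] -/
theorem settlesT2_minkowski : SettlesT2 Minkowski.vacuumCauchyDevelopment :=
  ⟨WeakCosmicCensorshipMGHD.Negative.minkowski_hasCompleteNullInfinity, minkowskiExterior, minkowskiDecomp,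
    fun i ↦ i.elim0, minkowskiExterior_eq_exteriorOf, raysStayInClosure_minkowski,
    hasExhaustiveCharts_minkowskiDecomp, isFutureOriented_minkowskiDecomp⟩

/-! ### All hypotheses of the crux hold at one certified development -/

/-- **The standing hypotheses of the crux hold together at the Minkowski development, maximality
included** (given `choquetBruhat_geroch_exists_mghd_cauchy`): MGHD
(`Minkowski.isMaximal_vacuumCauchyDevelopment`), complete `𝓘⁺`, (i) no extremal remnant, (ii) tame outer
region (`MinkowskiModel.minkowski_devHyp_of_isMaximal`, whose maximality hypothesis is now discharged).
[cite: ChoquetBruhatGeroch1969CMP, Thm. 3] -/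
theorem minkowski_devHyp (hcbg : choquetBruhat_geroch_exists_mghd_cauchy) :
    DevHyp Minkowski.vacuumCauchyDevelopment :=
  MinkowskiModel.minkowski_devHyp_of_isMaximal (Minkowski.isMaximal_vacuumCauchyDevelopment hcbg)

/-- **Every hypothesis AND the conclusion of the crux hold simultaneously at ONE certified maximal
development of an admissible datum** (given `choquetBruhat_geroch_exists_mghd_cauchy`): the trivial datum is
admissible, Minkowski space is its MGHD, `𝓘⁺` is complete, (i) and (ii) hold, and the T2 conclusion holds
(`settlesT2_minkowski`). The crux's hypothesis block is thus kernel-checked consistent and consistent with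
its conclusion — the "IsMaximal uncertifiable" caveat of every earlier census is gone.
[cite: ChristodoulouKlainerman1993, Thm. 1.0.2] -/
theorem cruxHypotheses_minkowski (hcbg : choquetBruhat_geroch_exists_mghd_cauchy) :
    trivialData ∈ admissibleVacuumData slice ∧ Minkowski.vacuumCauchyDevelopment.IsMaximal ∧
      _root_.Summit.FinalStateConjecture.HasCompleteNullInfinity
          Minkowski.vacuumCauchyDevelopment.toCauchyDevelopment ∧
        NoExtremalRemnant Minkowski.vacuumCauchyDevelopment ∧ TameOuter Minkowski.vacuumCauchyDevelopment ∧
          SettlesT2 Minkowski.vacuumCauchyDevelopment := by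
  obtain ⟨hmax, hscri, hi, hii⟩ := minkowski_devHyp hcbg
  exact ⟨trivialData_mem_admissibleVacuumData, hmax, hscri, hi, hii, settlesT2_minkowski⟩

end Summit.FinalStateConjecture.FinalStateConjecture.Theorems.ChannelsResolveTameDevelopmentsR.TrivialDatum

end
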